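import Summits.ResolutionOfSingularities.ResolutionOfSingularities.Theorems.FloorDescent3
import Summits.ResolutionOfSingularities.ResolutionOfSingularities.Theorems.FloorCutClasses
import Summits.ResolutionOfSingularities.ResolutionOfSingularities.Theorems.MaxContactCutFloorCut
import Literature.AlgebraicGeometry.Resolution.PointBlowupFlagTranslatedStep
import HarnessLib

/-!
# FloorDescent (4/6) — §7 (L3) THE TRANSVERSALITY LAW `transversality_law` (three variables; the only use of the floor)

Part of the node «FloorDescent» (decomp-res · lens-5 g34): the ORDER FLOOR cell `FloorCut.NoFloorTailsDeep` of the deep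
tight-defect column DECIDED IN KERNEL for every prime `p` and exponent `e` (statement, mechanism and honest placement in
the module docstring of `FloorDescent6`; record HOME/decomp-res-lens-5/g34/NODE-g34.md).  Verbatim slice of the farm-checked
monolith `HOME/decomp-res-lens-5/g34/FloorDescent.lean` (lines 928–1182); one namespace across the six slices.
-/

open MvPolynomial Finset
open scoped BigOperators Polynomial
open Literature.AlgebraicGeometry.Resolution
open Literature.AlgebraicGeometry.Resolution.Hauser2010
open Literature.AlgebraicGeometry.Resolution.PointBlowup
open Literature.AlgebraicGeometry.Resolution.HauserPerlega2024
open Summit.ResolutionOfSingularities.ResolutionOfSingularities.Theorems.TightDefectClasses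

namespace Summit.ResolutionOfSingularities.ResolutionOfSingularities.Theorems.FloorDescent


noncomputable section


/-! ## §7 (L3) THE TRANSVERSALITY LAW — on the ORDER FLOOR, a change of chart index forces the new centre OFF
the old exceptional hyperplane (`j_{t+1} ≠ j_t ⇒ b_{t+1}(j_t) ≠ 0`).  Three variables. -/

section Transversality

variable {σ : Type} [DecidableEq σ] [Fintype σ] {K : Type} [Field K]

/-- KILLING the variable `y_j` (restriction to the hyperplane `y_j = 0`). [folklore] -/
def killAt (j : σ) : MvPolynomial σ K →ₐ[K] MvPolynomial σ K :=
  MvPolynomial.aeval fun i => if i = j then 0 else X i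

omit [Fintype σ] in
/-- `killAt_X_self`: Auxiliary step of this node's calculus, VERBATIM from the lens file (see the module docstring);
the statement is its type. [folklore] -/
theorem killAt_X_self (j : σ) : killAt j (X j : MvPolynomial σ K) = 0 := by simp [killAt]

omit [Fintype σ] in
/-- `killAt_X_ne`: Auxiliary step of this node's calculus, VERBATIM from the lens file (see the module docstring);
the statement is its type. [folklore] -/
theorem killAt_X_ne (j : σ) {i : σ} (hij : i ≠ j) : killAt j (X i : MvPolynomial σ K) = X i := by
  simp [killAt, hij]

omit [Fintype σ] in
/-- `killAt_monomial`: Auxiliary step of this node's calculus, VERBATIM from the lens file (see the module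
docstring); the statement is its type. [folklore] -/
theorem killAt_monomial (j : σ) (d : σ →₀ ℕ) (c : K) :
    killAt j (monomial d c : MvPolynomial σ K) = if d j = 0 then monomial d c else 0 := by
  rw [killAt, aeval_monomial, MvPolynomial.algebraMap_eq]
  split_ifs with h
  · rw [monomial_eq]
    congr 1
    exact Finsupp.prod_congr fun i hi => by
      rw [if_neg]
      rintro rfl
      exact (Finsupp.mem_support_iff.mp hi) h
  · have hj : j ∈ d.support := Finsupp.mem_support_iff.mpr h
    rw [Finsupp.prod, ← Finset.mul_prod_erase _ _ hj, if_pos rfl, zero_pow h, zero_mul, mul_zero]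

omit [Fintype σ] in
/-- `coeff_killAt`: Auxiliary step of this node's calculus, VERBATIM from the lens file (see the module docstring);
the statement is its type. [folklore] -/
theorem coeff_killAt (j : σ) (G : MvPolynomial σ K) (d : σ →₀ ℕ) :
    coeff d (killAt j G) = if d j = 0 then coeff d G else 0 := by
  conv_lhs => rw [G.as_sum, map_sum, coeff_sum]
  simp only [killAt_monomial]
  split_ifs with h
  · rw [Finset.sum_eq_single d]
    · rw [if_pos h, coeff_monomial, if_pos rfl]
    · intro e _ hne
      split_ifs
      · rw [coeff_monomial, if_neg hne]
      · rw [coeff_zero]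
    · intro hd
      rw [if_pos h, coeff_monomial, if_pos rfl]
      exact MvPolynomial.notMem_support_iff.mp hd
  · refine Finset.sum_eq_zero fun e _ => ?_
    split_ifs with he
    · rw [coeff_monomial, if_neg]
      rintro rfl
      exact h he
    · rw [coeff_zero]

omit [Fintype σ] in
/-- `mem_support_killAt`: Auxiliary step of this node's calculus, VERBATIM from the lens file (see the module
docstring); the statement is its type. [folklore] -/
theorem mem_support_killAt {j : σ} {G : MvPolynomial σ K} {d : σ →₀ ℕ} (hd : d ∈ (killAt j G).support) :
    d ∈ G.support ∧ d j = 0 := by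
  rw [MvPolynomial.mem_support_iff, coeff_killAt] at hd
  by_cases h : d j = 0
  · rw [if_pos h] at hd; exact ⟨MvPolynomial.mem_support_iff.mpr hd, h⟩
  · rw [if_neg h] at hd; exact absurd rfl hd

omit [Fintype σ] in
/-- Killing `y_j` commutes with a shear based at `j' ≠ j` whose `y_j`-slope vanishes. [folklore] -/
theorem killAt_frame_shearArc {j j' : σ} (hjj' : j' ≠ j) {b : σ → K} (hb : b j = 0) (G : MvPolynomial σ K) :
    killAt j (frame j' (shearArc b) G) = frame j' (shearArc b) (killAt j G) := by
  have h : (killAt (K := K) j).comp (frame j' (shearArc b)) = (frame j' (shearArc b)).comp (killAt j) := by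
    refine MvPolynomial.algHom_ext fun i => ?_
    rw [AlgHom.comp_apply, AlgHom.comp_apply]
    by_cases hij' : i = j'
    · rw [hij', frame_X_self, killAt_X_ne j hjj', frame_X_self]
    · rw [frame_X_ne j' _ hij', toLine_shearArc, map_add, map_mul, algHom_C, killAt_X_ne j hjj']
      by_cases hij : i = j
      · rw [hij, killAt_X_self, hb, map_zero, map_zero, zero_mul, add_zero]
      · rw [killAt_X_ne j hij, frame_X_ne j' _ hij', toLine_shearArc, MvPolynomial.algebraMap_eq]
  exact DFunLike.congr_fun h G

/-- ALL DEGREE-`q` MONOMIALS ARE `q`-TH POWERS (the degree-`q` part lies in `K[y^q]`). -/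
def IsQPowAt (q : ℕ) (G : MvPolynomial σ K) : Prop := ∀ d ∈ G.support, d.degree = q → IsPthPowerExponent q d

omit [DecidableEq σ] [Fintype σ] in
/-- `isQPowAt_iff`: Auxiliary step of this node's calculus, VERBATIM from the lens file (see the module docstring);
the statement is its type. [folklore] -/
theorem isQPowAt_iff (q : ℕ) (G : MvPolynomial σ K) : IsQPowAt q G ↔ IsQPow q (homogeneousComponent q G) := by
  constructor
  · intro h d hd
    rw [MvPolynomial.mem_support_iff, coeff_homogeneousComponent] at hd
    by_cases hdeg : d.degree = q
    · rw [if_pos hdeg] at hd; exact h d (MvPolynomial.mem_support_iff.mpr hd) hdeg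
    · rw [if_neg hdeg] at hd; exact absurd rfl hd
  · intro h d hd hdeg
    refine h d (MvPolynomial.mem_support_iff.mpr ?_)
    rw [coeff_homogeneousComponent, if_pos hdeg]
    exact MvPolynomial.mem_support_iff.mp hd

omit [Fintype σ] in
/-- A shear is homogeneous-degree preserving: it commutes with taking homogeneous components. [folklore] -/
theorem homogeneousComponent_frame_shearArc (j : σ) (b : σ → K) (n : ℕ) (G : MvPolynomial σ K) :
    homogeneousComponent n (frame j (shearArc b) G) = frame j (shearArc b) (homogeneousComponent n G) := by
  have hhom : ∀ k, (frame j (shearArc b) (homogeneousComponent k G)).IsHomogeneous k := fun k => by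
    have := (homogeneousComponent_isHomogeneous k G).aeval
      (fun i => if i = j then (X j : MvPolynomial σ K) else X i + toLine j (shearArc b i)) (n := 1) fun i => by
        by_cases hij : i = j
        · rw [if_pos hij]; exact isHomogeneous_X K j
        · rw [if_neg hij, toLine_shearArc]; exact (isHomogeneous_X K i).add ((isHomogeneous_X K j).C_mul _)
    rwa [one_mul] at this
  conv_lhs => rw [← sum_homogeneousComponent G, map_sum, map_sum]
  rw [Finset.sum_congr rfl fun k _ =>
    homogeneousComponent_of_mem (m := n) ((mem_homogeneousSubmodule k _).mpr (hhom k)), Finset.sum_ite_eq]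
  split_ifs with h
  · rfl
  · rw [homogeneousComponent_eq_zero _ _ (by simpa [Finset.mem_range, Nat.lt_succ_iff] using h), map_zero]

omit [Fintype σ] in
/-- `IsQPowAt` is invariant under shears (characteristic `p`, `q = p^e`). [folklore] -/
theorem isQPowAt_of_frame_shearArc {p : ℕ} [Fact p.Prime] [CharP K p] {e : ℕ} {j : σ} {b : σ → K}
    {G : MvPolynomial σ K} (h : IsQPowAt (p ^ e) (frame j (shearArc b) G)) : IsQPowAt (p ^ e) G := by
  rw [isQPowAt_iff] at h ⊢
  rw [homogeneousComponent_frame_shearArc] at h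
  have := h.map_algHom (frame j (-shearArc b))
  rwa [frame_neg_frame] at this

omit [Fintype σ] in
/-- No monomial of degree `q` can be cancelled by cleaning in a `IsQPowAt` way: cleaning preserves `IsQPowAt`
downwards. [folklore] -/
theorem isQPowAt_of_deletePthPowers {q : ℕ} {G : MvPolynomial σ K} (h : IsQPowAt q (deletePthPowers q G)) :
    IsQPowAt q G := by
  intro d hd hdeg
  by_contra hnot
  refine hnot (h d (MvPolynomial.mem_support_iff.mpr ?_) hdeg)
  rw [coeff_deletePthPowers, if_neg hnot]
  exact MvPolynomial.mem_support_iff.mp hd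

/-- **(A) EQUIMULTIPLICITY IN CONE FORM.**  If `ord Φ ≥ q` and `chart_j Φ` has no monomials of degree in
`(0, q)` (equimultiplicity of the centre), then every degree-`q` monomial of `Φ` is `y_j^q` or is free of `y_j`.
[folklore] -/
theorem offDeg_eq_zero_or_apply_eq_zero {q : ℕ} {j : σ} {Φ : MvPolynomial σ K} (hΦ : OrdGE q Φ)
    (heq : ∀ d, d ≠ 0 → d.degree < q → coeff d (chartTransform q j Φ) = 0) :
    ∀ d ∈ Φ.support, d.degree = q → offDeg j d = 0 ∨ d j = 0 := by
  intro d hd hdeg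
  by_contra h
  rw [not_or] at h
  have h1 := degree_eq_offDeg_add j d
  have h2 : (chartExponent q j d).degree = offDeg j d := by rw [degree_chartExponent, hdeg, tsub_self, add_zero]
  have h3 : chartExponent q j d ≠ 0 := fun h0 => h.1 (by rw [← h2, h0, map_zero])
  have h4 := heq _ h3 (by rw [h2]; omega)
  rw [coeff_chartExponent_chartTransform q j hΦ hd] at h4
  exact (MvPolynomial.mem_support_iff.mp hd) h4

/-- **(B) THE NEXT STAGE SEES THE `y_j`-FREE DEGREE-`q` PART.**  If the `y_j`-free part of
`clean(chart_j Φ)` has all its degree-`q` monomials `q`-th powers, then so does the `y_j`-free degree-`q` part of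
`Φ`. [folklore] -/
theorem isPth_of_killAt_clean_chart {q : ℕ} {j : σ} {Φ : MvPolynomial σ K} (hΦ : OrdGE q Φ)
    (hQ : IsQPowAt q (killAt j (deletePthPowers q (chartTransform q j Φ)))) :
    ∀ d ∈ Φ.support, d.degree = q → d j = 0 → IsPthPowerExponent q d := by
  intro d hd hdeg hdj
  by_contra hnot
  have hexp : chartExponent q j d = d := by
    ext i
    rw [chartExponent_apply]
    split_ifs with hi
    · rw [hi, hdj, hdeg, tsub_self]
    · rfl
  have h1 : coeff d (chartTransform q j Φ) = coeff d Φ := by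
    have := coeff_chartExponent_chartTransform q j hΦ hd
    rwa [hexp] at this
  refine hnot (hQ d (MvPolynomial.mem_support_iff.mpr ?_) hdeg)
  rw [coeff_killAt, if_pos hdj, coeff_deletePthPowers, if_neg hnot, h1]
  exact MvPolynomial.mem_support_iff.mp hd

/-- In THREE variables an exponent of degree `q` vanishing at two distinct indices is `q` times the third
unit vector. [folklore] -/
theorem isPthPowerExponent_of_two_zero {q : ℕ} {j j' : Fin 3} (hjj' : j' ≠ j) (d : Fin 3 →₀ ℕ)
    (hj : d j = 0) (hj' : d j' = 0) (hdeg : d.degree = q) : IsPthPowerExponent q d := by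
  rw [isPthPowerExponent_iff]
  intro i
  by_cases hij : i = j
  · rw [hij, hj]; exact dvd_zero q
  by_cases hij' : i = j'
  · rw [hij', hj']; exact dvd_zero q
  suffices h : d i = q by rw [h]
  have hsum := Finsupp.degree_eq_sum d
  rw [Fin.sum_univ_three, hdeg] at hsum
  fin_cases i <;> fin_cases j <;> fin_cases j' <;> simp_all

/-- **(L3) THE TRANSVERSALITY LAW** (three variables, `q = p^e`, characteristic `p`).  On the ORDER FLOOR
(`F` cleaned, `ord F ≥ q`, and `F` HAS a monomial of degree `q`), if `(j, b)` is an equimultiple centre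
(`b_j = 0`) and `(j', b')` is an equimultiple centre of the next equation `F' = clean(τ_b chart_j F)` with
`j' ≠ j` and `b'_{j'} = 0`, then `b'_j ≠ 0`: the new centre lies OFF the old exceptional hyperplane.
(Else the `y_j`-free degree-`q` part of `F`, read at stage `t+1` through `y_j = 0`, and the rest of the
degree-`q` part, read at stage `t`, are `q`-th powers — contradicting cleanedness on the floor.)  CONSUMES: the
FLOOR `ord F_t = q` (its ONLY use in the node), cleanedness of `F_t`, `onExc` and `equimult` at `t` and `t+1`.
[folklore] -/
theorem transversality_law {p : ℕ} [Fact p.Prime] [CharP K p] (e : ℕ) {F : MvPolynomial (Fin 3) K}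
    (hclean : deletePthPowers (p ^ e) F = F) (hord : OrdGE (p ^ e) F)
    (hfloor : ∃ d ∈ F.support, d.degree = p ^ e)
    {j : Fin 3} {b : Fin 3 → K} (hbj : b j = 0)
    (heq : ∀ d, d ≠ 0 → d.degree < p ^ e →
      coeff d (PointBlowup.translate b (chartTransform (p ^ e) j F)) = 0)
    {j' : Fin 3} {b' : Fin 3 → K} (hbj' : b' j' = 0) (hjj' : j' ≠ j) (hb'j : b' j = 0)
    (heq' : ∀ d, d ≠ 0 → d.degree < p ^ e →
      coeff d (PointBlowup.translate b' (chartTransform (p ^ e) j'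
        (deletePthPowers (p ^ e) (PointBlowup.translate b (chartTransform (p ^ e) j F))))) = 0) : False := by
  set q := p ^ e with hq
  set Φ := frame j (shearArc b) F with hΦ
  have hΦord : OrdGE q Φ := hord.frame j _ (shearArc_coeff_zero b)
  rw [translate_chartTransform q j b hbj hord] at heq heq'
  set F' := deletePthPowers q (chartTransform q j Φ) with hF'
  -- `ord F' ≥ q` from equimultiplicity at stage `t` (the constant is removed by cleaning)
  have hF'ord : OrdGE q F' := by
    intro d hd
    have hnot := not_isPthPowerExponent_of_mem_support_deletePthPowers hd
    have hd0 : d ≠ 0 := by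
      rintro rfl; exact hnot ((isPthPowerExponent_iff q 0).mpr fun i => dvd_zero q)
    by_contra hlt
    rw [not_le] at hlt
    rw [MvPolynomial.mem_support_iff, coeff_deletePthPowers, if_neg hnot] at hd
    exact hd (heq d hd0 hlt)
  rw [translate_chartTransform q j' b' hbj' hF'ord] at heq'
  set Φ' := frame j' (shearArc b') F' with hΦ'
  have hΦ'ord : OrdGE q Φ' := hF'ord.frame j' _ (shearArc_coeff_zero b')
  have hA := offDeg_eq_zero_or_apply_eq_zero hΦord heq
  have hA' := offDeg_eq_zero_or_apply_eq_zero hΦ'ord heq'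
  -- stage t+1: the `y_j`-free degree-`q` part of `Φ'` consists of `q`-th powers
  have h1 : IsQPowAt q (killAt j Φ') := by
    intro d hd hdeg
    obtain ⟨hd', hdj⟩ := mem_support_killAt hd
    rcases hA' d hd' hdeg with hoff | hdj'
    · rw [isPthPowerExponent_iff]
      intro i
      by_cases hi : i = j'
      · rw [hi, show d j' = q by have := degree_eq_offDeg_add j' d; omega]
      · rw [(offDeg_eq_zero_iff j' d).mp hoff i hi]; exact dvd_zero q
    · exact isPthPowerExponent_of_two_zero hjj' d hdj hdj' hdeg
  have h2 : killAt j Φ' = frame j' (shearArc b') (killAt j F') := killAt_frame_shearArc hjj' hb'j F'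
  rw [h2] at h1
  have h3 : IsQPowAt q (killAt j F') := isQPowAt_of_frame_shearArc h1
  -- killing `y_j` commutes with cleaning
  have h3' : IsQPowAt q (killAt j (deletePthPowers q (chartTransform q j Φ))) := h3
  have h4 := isPth_of_killAt_clean_chart hΦord h3'
  -- stage t: every degree-`q` monomial of `Φ` is a `q`-th power
  have h5 : IsQPowAt q Φ := by
    intro d hd hdeg
    rcases hA d hd hdeg with hoff | hdj
    · rw [isPthPowerExponent_iff]
      intro i
      by_cases hi : i = j
      · rw [hi, show d j = q by have := degree_eq_offDeg_add j d; omega]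
      · rw [(offDeg_eq_zero_iff j d).mp hoff i hi]; exact dvd_zero q
    · exact h4 d hd hdeg hdj
  have h6 : IsQPowAt q F := isQPowAt_of_frame_shearArc h5
  obtain ⟨d, hd, hdeg⟩ := hfloor
  exact CampaignW46.MohWindowShadeAnchorOrder.not_isPthPowerExponent_of_cleaned hclean hd (h6 d hd hdeg)

end Transversality

end

end Summit.ResolutionOfSingularities.ResolutionOfSingularities.Theorems.FloorDescent
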